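import Summits.QuantumFields.BalabanUV.T4Continuum.Support.NE7PeriodicBlockSums
import Summits.QuantumFields.BalabanUV.T4Continuum.Support.NE3MajorantProfile
import HarnessLib

/-!
# NE7MajorantL1 — the `L¹(period box)` norm of the positive majorant tower of `NE3QbarIterMajorant` is `≤ K_maj·(L∕L^d)^{k+1}`, hence
# R2∕R4's (160) hypothesis holds UNCONDITIONALLY: `Σ_{z ∈ periodBox N} Σ_κ ‖QbarIter (k+1) U Y − QbarIter (k+1) ♭ Y‖(z,κ) ≤ 2K_maj·(L∕L^d)^{k+1}·dirL1 Y`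

Cell `pub-balaban`, rung (B)+1 sub-cell t4, lineage `b2b-balaban-t4-ne7-p1`, generation 74 (CRUX PROVER NE7 #1, OWNER row NE7).  Memo `REP-FLAT-ROAD-v4.md` §4.
THE POINT.  `NE3QbarIterMajorant.norm_QbarIter_le_majIter` dominates `‖QbarIter L (j+1) W Y‖` POINTWISE, for EVERY unitary `W` of the multi-level small-field class (no
gauge condition: the covariant line average has the flat `ℓ¹` weights, the transports being isometries), by the positive linear tower `majIter d L (j+1) x ω` of any
weight `ω ≥ ‖Y‖`.  This file computes that tower's `L¹` norm between period boxes: one straight step contracts the mass by EXACTLY `L∕L^d` (`L` bonds per coarse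
bond, `L^d` lines per block — `NE7PeriodicBlockSums.sum_periodBox_block_shift_le`), the local defect step costs `≤ c_loc(d,L)` (word weights, `sum_periodBox_lsum_le`)
times `wlin d L xᵢ`, and `Σᵢ xᵢ ≤ 2∕twoLevelSmall` along the radii of the class (`xᵢ₊₁ ≥ L²xᵢ`, `twoLevelSmall·x_k ≤ 1`) — so the product of the `k+1` step norms
is `≤ K_maj(d,L)·(L∕L^d)^{k+1}` with a `k`-FREE constant.  By the triangle inequality (no deficit needed) the (160) hypothesis `hΛ` of R2
`NE7CriticalTensionLetter.norm_tension_le_of_tanCritical` ∕ R4 `NE7CovDivB8Letter.norm_covDiv_le_of_tanCritical` holds with `Λ = 2K_maj·(L∕L^d)^{k+1}` — the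
same order as R4's companion term `(L∕L^d)^{k+1}`, so R4's current bound is `O(ε∕M)` as (1.9) wants.

WHAT ([folklore]; 0 def, 0 sorry; every dimension `d`).
§1 periodicity of the block functionals (`segW_add_period`, `loopW_add_period`, `treeW'_add_period`, `locW_add_period`, `stepMaj_add_period`).
§2 ONE LEVEL in `L¹`: `sum_periodBox_segStep_le` (`≤ (L∕L^d)·Σ ω(·,κ)`), `sum_periodBox_locStep_le` (`≤ c_loc·‖ω‖₁`, `c_loc = 1250(nbRad + L) + 8dL + 2L`),
   `sum_periodBox_stepMaj_le` (`≤ (L∕L^d + d·wlin(x)·c_loc)·‖ω‖₁`).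
§3 THE TOWER: `iterate_prop1Radius_nonneg`, `sum_periodBox_majIter_le` (`≤ Π_{i<j}(L∕L^d + d·wlin(xᵢ)·c_loc)·‖ω‖₁`); the radii bookkeeping `pow_mul_le_iterate_prop1Radius`,
   `levelSmall_iterate`, `sum_iterate_prop1Radius_le`; `prod_step_le` (`Π ≤ K_maj·(L∕L^d)^{k+1}`, `K_maj = exp((L^d∕L)·d·c_loc·16(d+1)(d+4)L²·2∕twoLevelSmall)`).
§4 **`sum_norm_QbarIter_sub_flat_le`**: for unitary `W`, `0 ≤ x`, `LevelSmall d L k x`, `SmallField W x`, `L ≥ 2`, and `Y` periodic of period `N·L^{k+1}`: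
   `Σ_{z ∈ periodBox N} Σ_κ ‖QbarIter L (k+1) W Y z κ − QbarIter L (k+1) ♭ Y z κ‖ ≤ 2K_maj·(L∕L^d)^{k+1}·dirL1 Y (periodBox (N·L^{k+1}))`.

HONEST FRAMING (page 1): kinematics of the linearised averaging tower (an operator-norm count); nothing about minimisers; (160) is now a theorem but REP♭∕(APE)∕NE7
are NOT proved HERE; spine 0∕9; finite T⁴ rung (B)+1 — NOT infinite volume, NOT mass gap, NOT Clay.  Continuum YM on T⁴ ⇐ BetaPertH ∧ nine spine estimates
(0/9 proved); BetaPertH ⇐ (D1) ∧ (D4) ∧ CAP+tail; G-an2-4 gates asym, D1 and NE2/3/4.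
-/

set_option autoImplicit false

open scoped BigOperators Matrix.Norms.L2Operator
open Finset

namespace Summit.QuantumFields.BalabanUV.T4Continuum.NE7MajorantL1

open Literature.MathematicalPhysics.QuantumFieldTheory.Balaban1983to89
open B7Prop1Explicit B7Prop2Explicit
open T4AveragingDeficitWall (IsUnitaryCfg SmallField dirL1 flat_mem_classes)
open T4AveragingDeficitWallBoundary (periodBox)
open AveragingDeficitPeriodicCounting (IsPeriodicDir)
open AveragingDeficitSideDeriv (loopWord)
open AveragingDeficitTwoLevelPrep (prop1Radius twoLevelSmall)
open AveragingDeficitMultiLevelPrep (LevelSmall prop1Radius_nonneg)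
open BlockAverageVaryHolo (nbRad length_loopWord_le)
open BlockAveragePushDirSplit (flat sum_blockWeight_eq_one)
open NE3TangentCovariantTower (QbarIter)
open NE3QbarIterMajorant (lsum lsum_nil lsum_cons segW loopW treeW' locW wlin wlin_nonneg segStep locStep stepMaj stepMaj_apply stepMaj_nonneg majIter
  majIter_zero majIter_succ norm_QbarIter_le_majIter)
open NE3MajorantProfile (lsum_seg_eq_sum)
open NE7PeriodicBlockSums (lsum_add_period sum_periodBox_block_shift_le sum_periodBox_lsum_le)

noncomputable section

variable {d : ℕ}

/-! ## §1 Periodicity of the block functionals -/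

section Periodic

variable {ω : Site d → Fin d → ℝ} {T : ℤ} (hω : ∀ (y : Site d) (i : Fin d) (μ : Fin d), ω (y + T • e i) μ = ω y μ)
include hω

/-- `segW` of a `T`-periodic weight is `T`-periodic in the corner. [folklore] -/
theorem segW_add_period (L : ℕ) (q : Site d) (i κ : Fin d) : segW L ω (q + T • e i) κ = segW L ω q κ := by
  unfold segW
  refine Finset.sum_congr rfl fun r _ => ?_
  rw [show q + T • e i + boxVec L r = (q + boxVec L r) + T • e i by abel, lsum_add_period hω]

/-- `loopW` of a `T`-periodic weight is `T`-periodic in the corner. [folklore] -/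
theorem loopW_add_period (L : ℕ) (q : Site d) (i κ : Fin d) : loopW L ω (q + T • e i) κ = loopW L ω q κ := by
  unfold loopW
  refine Finset.sum_congr rfl fun r _ => ?_
  rw [lsum_add_period hω]

/-- `treeW'` of a `T`-periodic weight is `T`-periodic in the corner. [folklore] -/
theorem treeW'_add_period (L : ℕ) (q : Site d) (i κ : Fin d) : treeW' L ω (q + T • e i) κ = treeW' L ω q κ := by
  unfold treeW'
  refine Finset.sum_congr rfl fun r _ => ?_
  rw [show q + T • e i + (L : ℤ) • e κ = (q + (L : ℤ) • e κ) + T • e i by abel, lsum_add_period hω]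

/-- `locW` of a `T`-periodic weight is `T`-periodic in the corner. [folklore] -/
theorem locW_add_period (L : ℕ) (q : Site d) (i κ : Fin d) : locW L ω (q + T • e i) κ = locW L ω q κ := by
  unfold locW
  rw [loopW_add_period hω, treeW'_add_period hω, lsum_add_period hω]

end Periodic

/-- The majorant step of an `(QL)`-periodic weight is `Q`-periodic on the coarse lattice. [folklore] -/
theorem stepMaj_add_period (L : ℕ) {Q : ℕ} (x : ℝ) {ω : Site d → Fin d → ℝ}
    (hω : ∀ (y : Site d) (i : Fin d) (μ : Fin d), ω (y + ((Q * L : ℕ) : ℤ) • e i) μ = ω y μ) (z : Site d) (i κ : Fin d) :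
    stepMaj d L x ω (z + (Q : ℤ) • e i) κ = stepMaj d L x ω z κ := by
  have hq : (L : ℤ) • (z + (Q : ℤ) • e i) = (L : ℤ) • z + ((Q * L : ℕ) : ℤ) • e i := by
    rw [smul_add, smul_smul]; push_cast; rw [mul_comm]
  rw [stepMaj_apply, stepMaj_apply, hq, segW_add_period hω, locW_add_period hω]

/-! ## §2 One level in `L¹` -/

section OneLevel

variable {P L : ℕ} [NeZero P] (hL : 1 ≤ L) {ω : Site d → Fin d → ℝ} (hω0 : ∀ (y : Site d) (μ : Fin d), 0 ≤ ω y μ)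
  (hωP : ∀ (y : Site d) (i : Fin d) (μ : Fin d), ω (y + ((P * L : ℕ) : ℤ) • e i) μ = ω y μ)
include hL hω0 hωP

/-- **THE STRAIGHT STEP CONTRACTS THE MASS BY `L∕L^d`**: `Σ_{z ∈ periodBox P} segStep L ω z κ ≤ (L∕L^d)·Σ_{y ∈ periodBox (PL)} ω(y, κ)`. [folklore] -/
theorem sum_periodBox_segStep_le (κ : Fin d) :
    ∑ z ∈ periodBox (d := d) P, segStep L ω z κ ≤ ((L : ℝ) / (L : ℝ) ^ d) * ∑ y ∈ periodBox (d := d) (P * L), ω y κ := by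
  have hblk : ∀ t : ℕ, ∑ z ∈ periodBox (d := d) P, ∑ r : Fin d → Fin L, ω ((L : ℤ) • z + boxVec L r + (t : ℤ) • e κ) κ
      ≤ ∑ y ∈ periodBox (d := d) (P * L), ω y κ :=
    fun t => sum_periodBox_block_shift_le hL (f := fun y => ω y κ) (fun y => hω0 y κ) (fun y i => hωP y i κ) _
  have hz : ∀ z : Site d, segStep L ω z κ
      = ((L : ℝ) ^ d)⁻¹ * ∑ t ∈ Finset.range L, ∑ r : Fin d → Fin L, ω ((L : ℤ) • z + boxVec L r + (t : ℤ) • e κ) κ := by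
    intro z
    simp only [segStep, segW, lsum_seg_eq_sum]
    rw [← Finset.mul_sum, Finset.sum_comm]
  simp only [hz]
  rw [← Finset.mul_sum, Finset.sum_comm]
  calc ((L : ℝ) ^ d)⁻¹ * ∑ t ∈ Finset.range L, ∑ z ∈ periodBox (d := d) P, ∑ r : Fin d → Fin L, ω ((L : ℤ) • z + boxVec L r + (t : ℤ) • e κ) κ
      ≤ ((L : ℝ) ^ d)⁻¹ * ∑ _t ∈ Finset.range L, ∑ y ∈ periodBox (d := d) (P * L), ω y κ :=
        mul_le_mul_of_nonneg_left (Finset.sum_le_sum fun t _ => hblk t) (by positivity)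
    _ = ((L : ℝ) / (L : ℝ) ^ d) * ∑ y ∈ periodBox (d := d) (P * L), ω y κ := by
        rw [Finset.sum_const, Finset.card_range, nsmul_eq_mul, div_eq_mul_inv]; ring

/-- **THE LOCAL DEFECT STEP COSTS `c_loc`**: `Σ_{z ∈ periodBox P} locStep L ω z κ ≤ (1250(nbRad + L) + 8dL + 2L)·‖ω‖_{L¹(periodBox (PL))}`. [folklore] -/
theorem sum_periodBox_locStep_le (κ : Fin d) :
    ∑ z ∈ periodBox (d := d) P, locStep L ω z κ
      ≤ (1250 * ((nbRad d L : ℝ) + L) + 8 * ((d : ℝ) * L) + 2 * L) * ∑ y ∈ periodBox (d := d) (P * L), ∑ μ : Fin d, ω y μ := by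
  set S : ℝ := ∑ y ∈ periodBox (d := d) (P * L), ∑ μ : Fin d, ω y μ with hS
  have hS0 : 0 ≤ S := Finset.sum_nonneg fun y _ => Finset.sum_nonneg fun μ _ => hω0 y μ
  have hc0 : (0 : ℝ) ≤ ((L : ℝ) ^ d)⁻¹ := by positivity
  -- the corner segment
  have hseg : ∑ z ∈ periodBox (d := d) P, lsum ω ((L : ℤ) • z) (seg κ (L : ℤ)) ≤ (L : ℝ) * S := by
    have h := sum_periodBox_lsum_le hL hω0 hωP (seg κ (L : ℤ)) 0
    simp only [add_zero, length_seg, Int.natAbs_natCast] at h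
    exact h
  -- the loops
  have hloop : ∑ z ∈ periodBox (d := d) P, loopW L ω ((L : ℤ) • z) κ ≤ (nbRad d L : ℝ) * S := by
    simp only [loopW]
    rw [Finset.sum_comm]
    calc ∑ r : Fin d → Fin L, ∑ z ∈ periodBox (d := d) P, ((L : ℝ) ^ d)⁻¹ * lsum ω ((L : ℤ) • z) (loopWord L κ (boxVec L r))
        ≤ ∑ _r : Fin d → Fin L, ((L : ℝ) ^ d)⁻¹ * ((nbRad d L : ℝ) * S) := by
          refine Finset.sum_le_sum fun r _ => ?_
          rw [← Finset.mul_sum]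
          refine mul_le_mul_of_nonneg_left ?_ hc0
          have h := sum_periodBox_lsum_le hL hω0 hωP (loopWord L κ (boxVec L r)) 0
          simp only [add_zero] at h
          refine h.trans (mul_le_mul_of_nonneg_right ?_ hS0)
          exact_mod_cast length_loopWord_le L κ r
      _ = (nbRad d L : ℝ) * S := by rw [← Finset.sum_mul, sum_blockWeight_eq_one L hL, one_mul]
  -- the trees
  have htree : ∑ z ∈ periodBox (d := d) P, treeW' L ω ((L : ℤ) • z) κ ≤ ((d : ℝ) * L) * S := by
    simp only [treeW']
    rw [Finset.sum_comm]
    calc ∑ r : Fin d → Fin L, ∑ z ∈ periodBox (d := d) P, ((L : ℝ) ^ d)⁻¹ * lsum ω ((L : ℤ) • z + (L : ℤ) • e κ) (treeWord (boxVec L r))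
        ≤ ∑ _r : Fin d → Fin L, ((L : ℝ) ^ d)⁻¹ * (((d : ℝ) * L) * S) := by
          refine Finset.sum_le_sum fun r _ => ?_
          rw [← Finset.mul_sum]
          refine mul_le_mul_of_nonneg_left ?_ hc0
          refine (sum_periodBox_lsum_le hL hω0 hωP (treeWord (boxVec L r)) _).trans (mul_le_mul_of_nonneg_right ?_ hS0)
          rw [length_treeWord]
          exact_mod_cast l1_boxVec_le L r
      _ = ((d : ℝ) * L) * S := by rw [← Finset.sum_mul, sum_blockWeight_eq_one L hL, one_mul]
  have hz : ∀ z : Site d, locStep L ω z κ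
      = 1250 * (loopW L ω ((L : ℤ) • z) κ + lsum ω ((L : ℤ) • z) (seg κ (L : ℤ))) + 8 * treeW' L ω ((L : ℤ) • z) κ
        + 2 * lsum ω ((L : ℤ) • z) (seg κ (L : ℤ)) := fun z => rfl
  simp only [hz, Finset.sum_add_distrib, ← Finset.mul_sum]
  nlinarith [hseg, hloop, htree, hS0]

/-- **ONE LEVEL**: `Σ_{z ∈ periodBox P} Σ_κ stepMaj d L x ω z κ ≤ (L∕L^d + d·wlin(x)·c_loc)·‖ω‖_{L¹(periodBox (PL))}` for `x ≥ 0`. [folklore] -/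
theorem sum_periodBox_stepMaj_le {x : ℝ} (hx : 0 ≤ x) :
    ∑ z ∈ periodBox (d := d) P, ∑ κ : Fin d, stepMaj d L x ω z κ
      ≤ ((L : ℝ) / (L : ℝ) ^ d + (d : ℝ) * wlin d L x * (1250 * ((nbRad d L : ℝ) + L) + 8 * ((d : ℝ) * L) + 2 * L))
          * ∑ y ∈ periodBox (d := d) (P * L), ∑ μ : Fin d, ω y μ := by
  set S : ℝ := ∑ y ∈ periodBox (d := d) (P * L), ∑ μ : Fin d, ω y μ with hS
  set c : ℝ := 1250 * ((nbRad d L : ℝ) + L) + 8 * ((d : ℝ) * L) + 2 * L with hc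
  rw [Finset.sum_comm]
  have hκ : ∀ κ : Fin d, ∑ z ∈ periodBox (d := d) P, stepMaj d L x ω z κ
      ≤ ((L : ℝ) / (L : ℝ) ^ d) * ∑ y ∈ periodBox (d := d) (P * L), ω y κ + wlin d L x * (c * S) := by
    intro κ
    simp only [stepMaj_apply]
    rw [Finset.sum_add_distrib, ← Finset.mul_sum]
    exact add_le_add (sum_periodBox_segStep_le hL hω0 hωP κ)
      (mul_le_mul_of_nonneg_left (sum_periodBox_locStep_le hL hω0 hωP κ) (wlin_nonneg d L hx))
  calc ∑ κ : Fin d, ∑ z ∈ periodBox (d := d) P, stepMaj d L x ω z κ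
      ≤ ∑ κ : Fin d, (((L : ℝ) / (L : ℝ) ^ d) * ∑ y ∈ periodBox (d := d) (P * L), ω y κ + wlin d L x * (c * S)) := Finset.sum_le_sum fun κ _ => hκ κ
    _ = ((L : ℝ) / (L : ℝ) ^ d) * S + (d : ℝ) * wlin d L x * (c * S) := by
        rw [Finset.sum_add_distrib, ← Finset.mul_sum, Finset.sum_const, Finset.card_univ, Fintype.card_fin, nsmul_eq_mul, hS,
          Finset.sum_comm]
        ring
    _ = _ := by ring

end OneLevel

/-! ## §3 The tower in `L¹`, the radii of the class, the `k`-free constant -/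

/-- The radii of the class are nonnegative: `0 ≤ prop1Radius^[m] x` for `x ≥ 0`. [folklore] -/
theorem iterate_prop1Radius_nonneg (L : ℕ) : ∀ (m : ℕ) {x : ℝ}, 0 ≤ x → 0 ≤ (prop1Radius d L)^[m] x
  | 0, _, hx => hx
  | m + 1, _, hx => by rw [Function.iterate_succ_apply]; exact iterate_prop1Radius_nonneg L m (prop1Radius_nonneg (d := d) hx)

/-- **THE TOWER IN `L¹`**: for `x ≥ 0` and a weight `ω ≥ 0` of period `P·L^j`,
`Σ_{z ∈ periodBox P} Σ_κ majIter d L j x ω z κ ≤ Π_{i<j}(L∕L^d + d·wlin(xᵢ)·c_loc)·‖ω‖_{L¹(periodBox (P·L^j))}`, `xᵢ = prop1Radius^[i] x`. [folklore] -/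
theorem sum_periodBox_majIter_le {L : ℕ} (hL : 1 ≤ L) : ∀ (j : ℕ) (P : ℕ) [NeZero P] (x : ℝ), 0 ≤ x →
    ∀ (ω : Site d → Fin d → ℝ), (∀ (y : Site d) (μ : Fin d), 0 ≤ ω y μ) →
      (∀ (y : Site d) (i : Fin d) (μ : Fin d), ω (y + ((P * L ^ j : ℕ) : ℤ) • e i) μ = ω y μ) →
      ∑ z ∈ periodBox (d := d) P, ∑ κ : Fin d, majIter d L j x ω z κ
        ≤ (∏ i ∈ Finset.range j, ((L : ℝ) / (L : ℝ) ^ d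
              + (d : ℝ) * wlin d L ((prop1Radius d L)^[i] x) * (1250 * ((nbRad d L : ℝ) + L) + 8 * ((d : ℝ) * L) + 2 * L)))
            * ∑ y ∈ periodBox (d := d) (P * L ^ j), ∑ μ : Fin d, ω y μ
  | 0, P, _, x, _, ω, _, _ => by simp
  | j + 1, P, _, x, hx, ω, hω0, hωP => by
    haveI : NeZero (P * L ^ j) := ⟨Nat.mul_ne_zero (NeZero.ne P) (pow_ne_zero _ (by omega))⟩
    have hper : ∀ (y : Site d) (i : Fin d) (μ : Fin d), ω (y + ((P * L ^ j * L : ℕ) : ℤ) • e i) μ = ω y μ := by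
      intro y i μ; rw [show P * L ^ j * L = P * L ^ (j + 1) by rw [pow_succ, mul_assoc]]; exact hωP y i μ
    -- the first step's output: nonnegative, `P·L^j`-periodic, mass `≤ c(x)·‖ω‖₁`
    have h0' : ∀ (y : Site d) (μ : Fin d), 0 ≤ stepMaj d L x ω y μ := stepMaj_nonneg d L hx hω0
    have hP' : ∀ (y : Site d) (i : Fin d) (μ : Fin d), stepMaj d L x ω (y + ((P * L ^ j : ℕ) : ℤ) • e i) μ = stepMaj d L x ω y μ :=
      fun y i μ => stepMaj_add_period L x hper y i μ
    have ih := sum_periodBox_majIter_le hL j P (prop1Radius d L x) (prop1Radius_nonneg (d := d) hx) (stepMaj d L x ω) h0' hP'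
    have hstep := sum_periodBox_stepMaj_le (P := P * L ^ j) hL hω0 hper hx
    rw [majIter_succ]
    refine ih.trans ?_
    rw [Finset.prod_range_succ', show P * L ^ (j + 1) = P * L ^ j * L by rw [pow_succ, mul_assoc]]
    simp only [← Function.iterate_succ_apply, Function.iterate_zero, id]
    rw [mul_assoc]
    refine mul_le_mul_of_nonneg_left hstep (Finset.prod_nonneg fun i _ => ?_)
    have := wlin_nonneg d L (iterate_prop1Radius_nonneg (d := d) L (i + 1) hx)
    positivity

/-- Radii grow at least by `L²` per level: `L^{2m}·x ≤ prop1Radius^[m] x` for `x ≥ 0`. [folklore] -/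
theorem pow_mul_le_iterate_prop1Radius (L : ℕ) : ∀ (m : ℕ) {x : ℝ}, 0 ≤ x → ((L : ℝ) ^ 2) ^ m * x ≤ (prop1Radius d L)^[m] x
  | 0, x, _ => by simp
  | m + 1, x, hx => by
    rw [Function.iterate_succ_apply', pow_succ, mul_comm (((L : ℝ) ^ 2) ^ m), mul_assoc]
    have ih := pow_mul_le_iterate_prop1Radius L m hx
    have hy : 0 ≤ (prop1Radius d L)^[m] x := iterate_prop1Radius_nonneg (d := d) L m hx
    calc (L : ℝ) ^ 2 * (((L : ℝ) ^ 2) ^ m * x) ≤ (L : ℝ) ^ 2 * (prop1Radius d L)^[m] x := mul_le_mul_of_nonneg_left ih (by positivity)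
      _ ≤ prop1Radius d L ((prop1Radius d L)^[m] x) := by
          unfold prop1Radius
          nlinarith [sq_nonneg (8 * ((d : ℝ) + 1) * ((d : ℝ) + 4) * (L : ℝ) ^ 2 * (prop1Radius d L)^[m] x)]

/-- The last radius of the class is small: `LevelSmall d L k x ⇒ twoLevelSmall·prop1Radius^[k] x ≤ 1`. [folklore] -/
theorem levelSmall_iterate (L : ℕ) : ∀ (k : ℕ) {x : ℝ}, LevelSmall d L k x → twoLevelSmall d L * (prop1Radius d L)^[k] x ≤ 1
  | 0, _, h => h
  | k + 1, _, h => by rw [Function.iterate_succ_apply]; exact levelSmall_iterate L k h.2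

/-- `Σ_{i ≤ k} xᵢ ≤ 2·x_k` for `L ≥ 2` (geometric growth of the radii). [folklore] -/
theorem sum_iterate_prop1Radius_le {L : ℕ} (hL : 2 ≤ L) (k : ℕ) {x : ℝ} (hx : 0 ≤ x) :
    ∑ i ∈ Finset.range (k + 1), (prop1Radius d L)^[i] x ≤ 2 * (prop1Radius d L)^[k] x := by
  have hL2 : (4 : ℝ) ≤ (L : ℝ) ^ 2 := by
    have : (2 : ℝ) ≤ L := by exact_mod_cast hL
    nlinarith
  have hq0 : (0 : ℝ) < (L : ℝ) ^ 2 := by linarith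
  have hxk : 0 ≤ (prop1Radius d L)^[k] x := iterate_prop1Radius_nonneg (d := d) L k hx
  -- `xᵢ ≤ x_k ∕ (L²)^{k−i}`
  have hi : ∀ i ∈ Finset.range (k + 1), (prop1Radius d L)^[i] x ≤ (prop1Radius d L)^[k] x * (((L : ℝ) ^ 2)⁻¹) ^ (k - i) := by
    intro i hi
    have hik : i ≤ k := Nat.lt_succ_iff.mp (Finset.mem_range.mp hi)
    have hxi : 0 ≤ (prop1Radius d L)^[i] x := iterate_prop1Radius_nonneg (d := d) L i hx
    have h := pow_mul_le_iterate_prop1Radius (d := d) L (k - i) hxi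
    rw [← Function.iterate_add_apply, Nat.sub_add_cancel hik] at h
    rw [inv_pow, ← div_eq_mul_inv, le_div_iff₀ (pow_pos hq0 _), mul_comm]
    exact h
  refine (Finset.sum_le_sum hi).trans ?_
  rw [← Finset.mul_sum]
  -- the geometric sum `Σ_{i ≤ k} q^{k−i} ≤ 1∕(1 − q) ≤ 4∕3 ≤ 2`, `q = 1∕L² ≤ 1∕4`
  have hq1 : ((L : ℝ) ^ 2)⁻¹ ≤ 1 / 4 := by rw [one_div]; exact inv_anti₀ (by norm_num) hL2
  have hqn : 0 ≤ ((L : ℝ) ^ 2)⁻¹ := by positivity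
  have hgeom : ∑ i ∈ Finset.range (k + 1), (((L : ℝ) ^ 2)⁻¹) ^ (k - i) ≤ 2 := by
    have hrefl := Finset.sum_range_reflect (fun i => (((L : ℝ) ^ 2)⁻¹) ^ i) (k + 1)
    simp only [Nat.add_sub_cancel] at hrefl
    rw [hrefl, geom_sum_eq (x := ((L : ℝ) ^ 2)⁻¹) (by linarith) (k + 1)]
    have hpow : 0 ≤ (((L : ℝ) ^ 2)⁻¹) ^ (k + 1) := pow_nonneg hqn _
    rw [div_le_iff_of_neg (by linarith)]
    nlinarith
  nlinarith

/-- **THE `k`-FREE CONSTANT**: under `LevelSmall d L k x` (`L ≥ 2`, `x ≥ 0`),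
`Π_{i<k+1}(L∕L^d + d·wlin(xᵢ)·c_loc) ≤ K_maj·(L∕L^d)^{k+1}`, `K_maj = exp((L^d∕L)·d·c_loc·16(d+1)(d+4)L²·(2∕twoLevelSmall))`. [folklore] -/
theorem prod_step_le {L : ℕ} (hL : 2 ≤ L) (k : ℕ) {x : ℝ} (hx : 0 ≤ x) (hs : LevelSmall d L k x) :
    ∏ i ∈ Finset.range (k + 1), ((L : ℝ) / (L : ℝ) ^ d
        + (d : ℝ) * wlin d L ((prop1Radius d L)^[i] x) * (1250 * ((nbRad d L : ℝ) + L) + 8 * ((d : ℝ) * L) + 2 * L))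
      ≤ Real.exp (((L : ℝ) ^ d / L) * ((d : ℝ) * (16 * ((d : ℝ) + 1) * ((d : ℝ) + 4) * (L : ℝ) ^ 2)
            * (1250 * ((nbRad d L : ℝ) + L) + 8 * ((d : ℝ) * L) + 2 * L)) * (2 / twoLevelSmall d L))
        * ((L : ℝ) / (L : ℝ) ^ d) ^ (k + 1) := by
  have hL0 : (0 : ℝ) < L := by exact_mod_cast (show 0 < L by omega)
  set a : ℝ := (L : ℝ) / (L : ℝ) ^ d with ha
  have ha0 : 0 < a := by rw [ha]; positivity
  set c : ℝ := 1250 * ((nbRad d L : ℝ) + L) + 8 * ((d : ℝ) * L) + 2 * L with hc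
  have hc0 : 0 ≤ c := by rw [hc]; positivity
  set b : ℕ → ℝ := fun i => (d : ℝ) * wlin d L ((prop1Radius d L)^[i] x) * c with hb
  have hxi : ∀ i, 0 ≤ (prop1Radius d L)^[i] x := fun i => iterate_prop1Radius_nonneg (d := d) L i hx
  have hb0 : ∀ i, 0 ≤ b i := fun i => by rw [hb]; exact mul_nonneg (mul_nonneg (Nat.cast_nonneg _) (wlin_nonneg d L (hxi i))) hc0
  -- `a + bᵢ ≤ a·exp(bᵢ∕a)`
  have hterm : ∀ i ∈ Finset.range (k + 1), a + b i ≤ a * Real.exp (b i / a) := by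
    intro i _
    have h := Real.add_one_le_exp (b i / a)
    have hba : a * (b i / a) = b i := by field_simp
    have : a + b i = a * (b i / a + 1) := by rw [mul_add, hba, mul_one, add_comm]
    rw [this]
    exact mul_le_mul_of_nonneg_left h ha0.le
  have hprod : ∏ i ∈ Finset.range (k + 1), (a + b i) ≤ ∏ i ∈ Finset.range (k + 1), a * Real.exp (b i / a) :=
    Finset.prod_le_prod (fun i _ => by linarith [hb0 i]) hterm
  refine hprod.trans ?_
  rw [Finset.prod_mul_distrib, Finset.prod_const, Finset.card_range, ← Real.exp_sum, mul_comm]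
  refine mul_le_mul_of_nonneg_right (Real.exp_le_exp.mpr ?_) (pow_nonneg ha0.le _)
  -- `Σ bᵢ∕a = (1∕a)·d·c·16(d+1)(d+4)L²·Σ xᵢ ≤ … · 2∕twoLevelSmall`
  have htls : 0 < twoLevelSmall d L := by unfold twoLevelSmall; positivity
  have hsumx : ∑ i ∈ Finset.range (k + 1), (prop1Radius d L)^[i] x ≤ 2 / twoLevelSmall d L := by
    refine (sum_iterate_prop1Radius_le (d := d) hL k hx).trans ?_
    rw [le_div_iff₀ htls]
    have := levelSmall_iterate (d := d) L k hs
    nlinarith [hxi k]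
  have hrw : ∑ i ∈ Finset.range (k + 1), b i / a
      = (1 / a) * ((d : ℝ) * (16 * ((d : ℝ) + 1) * ((d : ℝ) + 4) * (L : ℝ) ^ 2) * c) * ∑ i ∈ Finset.range (k + 1), (prop1Radius d L)^[i] x := by
    rw [Finset.mul_sum]
    refine Finset.sum_congr rfl fun i _ => ?_
    simp only [hb, wlin]
    field_simp
  rw [hrw, show (1 : ℝ) / a = (L : ℝ) ^ d / L by rw [ha, one_div, inv_div]]
  have hcoef : 0 ≤ (L : ℝ) ^ d / L * ((d : ℝ) * (16 * ((d : ℝ) + 1) * ((d : ℝ) + 4) * (L : ℝ) ^ 2) * c) := by positivity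
  exact mul_le_mul_of_nonneg_left hsumx hcoef

/-! ## §4 The (160) hypothesis, discharged -/

/-- **(160) HOLDS: `Σ_{z ∈ periodBox N} Σ_κ ‖QbarIter (k+1) W Y − QbarIter (k+1) ♭ Y‖(z,κ) ≤ 2K_maj·(L∕L^d)^{k+1}·dirL1 Y (periodBox (N·L^{k+1}))`** for every unitary `W`
of the multi-level small-field class (`0 ≤ x`, `LevelSmall d L k x`, `SmallField W x`, `L ≥ 2`) and every `(N·L^{k+1})`-periodic direction field `Y` — by the
triangle inequality and the `L¹` norm of the majorant tower at `W` and at `♭`. [folklore] -/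
theorem sum_norm_QbarIter_sub_flat_le {n : Type*} [Fintype n] [DecidableEq n] [Nonempty n] {L : ℕ} (hL : 2 ≤ L) (k : ℕ) {N : ℕ} [NeZero N]
    {W : Site d → Fin d → (Matrix n n ℂ)ˣ} {x : ℝ} (hWu : IsUnitaryCfg W) (hx : 0 ≤ x) (hs : LevelSmall d L k x) (hWx : SmallField W x)
    {Y : Site d → Fin d → Matrix n n ℂ} (hYP : IsPeriodicDir Y ((N * L ^ (k + 1) : ℕ) : ℤ)) :
    ∑ z ∈ periodBox (d := d) N, ∑ κ : Fin d, ‖QbarIter L (k + 1) W Y z κ - QbarIter L (k + 1) (flat (d := d) (n := n)) Y z κ‖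
      ≤ (2 * Real.exp (((L : ℝ) ^ d / L) * ((d : ℝ) * (16 * ((d : ℝ) + 1) * ((d : ℝ) + 4) * (L : ℝ) ^ 2)
            * (1250 * ((nbRad d L : ℝ) + L) + 8 * ((d : ℝ) * L) + 2 * L)) * (2 / twoLevelSmall d L))
          * ((L : ℝ) / (L : ℝ) ^ d) ^ (k + 1))
        * dirL1 Y (periodBox (d := d) (N * L ^ (k + 1))) := by
  have hL1 : 1 ≤ L := by omega
  set ω : Site d → Fin d → ℝ := fun y μ => ‖Y y μ‖ with hω
  have hω0 : ∀ (y : Site d) (μ : Fin d), 0 ≤ ω y μ := fun y μ => norm_nonneg _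
  have hωP : ∀ (y : Site d) (i : Fin d) (μ : Fin d), ω (y + ((N * L ^ (k + 1) : ℕ) : ℤ) • e i) μ = ω y μ := fun y i μ => by
    simp only [hω, hYP y i μ]
  have hdom : ∀ (y : Site d) (μ : Fin d), ‖Y y μ‖ ≤ ω y μ := fun y μ => le_rfl
  have hflat := flat_mem_classes (d := d) (n := n) hx
  have hW := norm_QbarIter_le_majIter hL1 k hWu hx hs hWx hdom
  have hF := norm_QbarIter_le_majIter hL1 k hflat.1 hx hs hflat.2 hdom
  have htower := sum_periodBox_majIter_le (d := d) hL1 (k + 1) N x hx ω hω0 hωP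
  have hK := prod_step_le (d := d) hL k hx hs
  have hS : ∑ y ∈ periodBox (d := d) (N * L ^ (k + 1)), ∑ μ : Fin d, ω y μ = dirL1 Y (periodBox (d := d) (N * L ^ (k + 1))) := rfl
  have hS0 : 0 ≤ dirL1 Y (periodBox (d := d) (N * L ^ (k + 1))) := by
    rw [← hS]; exact Finset.sum_nonneg fun y _ => Finset.sum_nonneg fun μ _ => hω0 y μ
  calc ∑ z ∈ periodBox (d := d) N, ∑ κ : Fin d, ‖QbarIter L (k + 1) W Y z κ - QbarIter L (k + 1) (flat (d := d) (n := n)) Y z κ‖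
      ≤ ∑ z ∈ periodBox (d := d) N, ∑ κ : Fin d, (majIter d L (k + 1) x ω z κ + majIter d L (k + 1) x ω z κ) :=
        Finset.sum_le_sum fun z _ => Finset.sum_le_sum fun κ _ => (norm_sub_le _ _).trans (add_le_add (hW z κ) (hF z κ))
    _ = 2 * ∑ z ∈ periodBox (d := d) N, ∑ κ : Fin d, majIter d L (k + 1) x ω z κ := by
        simp only [Finset.sum_add_distrib]; ring
    _ ≤ 2 * ((Real.exp (((L : ℝ) ^ d / L) * ((d : ℝ) * (16 * ((d : ℝ) + 1) * ((d : ℝ) + 4) * (L : ℝ) ^ 2)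
            * (1250 * ((nbRad d L : ℝ) + L) + 8 * ((d : ℝ) * L) + 2 * L)) * (2 / twoLevelSmall d L))
          * ((L : ℝ) / (L : ℝ) ^ d) ^ (k + 1)) * dirL1 Y (periodBox (d := d) (N * L ^ (k + 1)))) := by
        rw [hS] at htower
        exact mul_le_mul_of_nonneg_left (htower.trans (mul_le_mul_of_nonneg_right hK hS0)) (by norm_num)
    _ = _ := by ring

end

end Summit.QuantumFields.BalabanUV.T4Continuum.NE7MajorantL1
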